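import Summits.ValiantsHypothesis.ValiantsHypothesis.Theorems.LacunarySymmetroidMatrixDescartesCensusDoorA34NineInertia

/-!
# `MatrixDescartes` census — DOOR A at `(3,4)`: a three-letter `3 × 3` pencil with a SINGULAR letter has at most EIGHT positive determinant roots
# (the core of a top-separated null-null anatomy: `8 + 1 + 4 + 1 + 2 = 16`)

HONEST FRAMING.  Object-search cell `pub-symmetroid`, engine seat `val-sym-eng-2` (g7); helper row beside the registered strata line
`Cruxes/DoorA34/Lines/strata.lean` on stmt-ValiantsHypothesis-19980 (`DoorA34 = PosRootLawAt 3 4 18`: OPEN, typed, never asserted here), stubs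
`stub_nullTopCeiling` / `stub_nullNullCeiling`.  …DoorA34NineInertia proved that nine positive roots of a `(3,3)` determinant force all ten triple-sum
monomials and identified the cube coefficient `coeff(3·d_l) = det S_l`.  Read backwards:

* `det_letter_ne_zero_of_nine` — a `(3,3)` nine-row has every letter NONSINGULAR (`K = 3` twin of …DoorA34Letters' `det_letter_ne_zero_of_nineteen`);
* **`posRoots_le_eight_of_det_letter_eq_zero`** — if some letter is singular, the `(3,3)` determinant has at most `8` positive roots (any real letters, any
  exponents; sharp: the null-bottom core of the census null-null sixteen p583093 on `(0,1,4)` has exactly `8`, seat report HOME/DOOR-A34-ENG2G7-REPORT.md §3e).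

Role in the line: in the window accounting `core + j₁ + γ_M + j₂ + γ_T` of a TOP-separated null-null pencil the core is the null-BOTTOM three-letter pencil
(`det S₀ = 0`), so the core contributes `≤ 8` and the located INDEFINITE WINDOW LAW's `≤ 1 + 4 + 1 + 2` above it gives `≤ 16` — the bound of
`stub_nullNullCeiling`, attained by p583093 (`8 + 1 + 4 + 1 + 2`).  Nothing here bounds `ζ_sym(3,4)`; `DoorA34` and the three stubs stay OPEN; nothing on
`MatrixDescartes` (stmt-ValiantsHypothesis-18050) or `VP ≠ VNP` — VP≠VNP not moved.  [folklore] sparse Descartes; elementary.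
-/

-- `Summit.ValiantsHypothesis.ValiantsHypothesis.…` repeats a component by the D-0017 layout
-- (single-conjunct summit), which the `dupNamespace` linter flags; the name is mandated.
set_option linter.dupNamespace false

namespace Summit.ValiantsHypothesis.ValiantsHypothesis.Theorems.LacunarySymmetroidMatrixDescartes.Census

open Polynomial Finset
open scoped BigOperators Polynomial Matrix

/-- **A `(3,3)` nine-row has every letter nonsingular**: nine positive roots put `3·d_l` in the support and `coeff(3·d_l) = det S_l`. [folklore] -/
theorem det_letter_ne_zero_of_nine (d : Fin 3 → ℕ) (S : Fin 3 → Matrix (Fin 3) (Fin 3) ℝ)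
    (h9 : 9 ≤ ((Matrix.det (∑ l, ((X : ℝ[X]) ^ d l) • (S l).map C)).roots.toFinset.filter (fun t => 0 < t)).card) (l : Fin 3) :
    (S l).det ≠ 0 := by
  have hmem := NineInertia.mem_support_of_nine d S h9 l l l
  have h3 : d l + d l + d l = 3 * d l := by ring
  rw [h3, Polynomial.mem_support_iff, NineInertia.coeff_cube d S h9 l] at hmem
  exact hmem

/-- **SINGULAR LETTER ⇒ AT MOST EIGHT** positive roots for a three-letter `3 × 3` pencil determinant (any real letters, any exponents). [folklore] -/
theorem posRoots_le_eight_of_det_letter_eq_zero (d : Fin 3 → ℕ) (S : Fin 3 → Matrix (Fin 3) (Fin 3) ℝ) (l : Fin 3) (hl : (S l).det = 0) :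
    ((Matrix.det (∑ l, ((X : ℝ[X]) ^ d l) • (S l).map C)).roots.toFinset.filter (fun t => 0 < t)).card ≤ 8 := by
  by_contra h
  exact det_letter_ne_zero_of_nine d S (by omega) l hl

/-- Null-BOTTOM form (`det S₀ = 0`): the core of a top-separated null-null `(3,4)` pencil has at most eight positive roots. [folklore] -/
theorem posRoots_le_eight_of_nullBottom (d : Fin 3 → ℕ) (S : Fin 3 → Matrix (Fin 3) (Fin 3) ℝ) (h0 : (S 0).det = 0) :
    ((Matrix.det (∑ l, ((X : ℝ[X]) ^ d l) • (S l).map C)).roots.toFinset.filter (fun t => 0 < t)).card ≤ 8 :=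
  posRoots_le_eight_of_det_letter_eq_zero d S 0 h0

end Summit.ValiantsHypothesis.ValiantsHypothesis.Theorems.LacunarySymmetroidMatrixDescartes.Census
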